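import Mathlib
import Summits.Ventures.HodgeRepro.PeriodCloserC7Archimedean

/-!
# PeriodCloserC7ArchSimultaneity — (E2) at a real place in the slot exponents, and when the four lines can be served
by ONE `δ_w` (ROUTE-B §9.2 / §9.3 on the kernel)

Blind re-derivation cell `pub-hodge-repro`, seat night-2 (gen 3).  Target tree path
`lean/Summits/Ventures/HodgeRepro/PeriodCloserC7ArchSimultaneity.lean`.  Continues gen 0's
`PeriodCloserC7Archimedean.lean` ((9.1c): `ε_{ℂ/ℝ}(½, χ_k, ψ_δ) = −sgn(k) · sgn(Im δ)` for odd `k`, `+1` for even `k`, from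
Kudla Prop 3.8 (iv), (3.28), (3.29), (3.30)).

At a real place `w` of `k` (`K_w = ℂ`), TP1's condition (E2)_w for the line `W_j = (L, a_j x ȳ)` reads
`ω_w(a_j) = ε_w(½, χ′_j, ψ_δ)`, with `ω_w(a_j) = sgn(a_j(w))` the signature of the line at `w` and the right side given by
(9.1c) in the slot exponent `k_j(w)` of `χ′_j` at `w` and the sign `sgn(Im δ_w)` of the ONE `δ_w` shared by the four lines:

    (9.2)   sgn(a_j(w)) = −sgn(k_j(w)) · sgn(Im δ_w)        (`k_j(w)` odd — the conjugate-symplectic case).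

ROUTE-B §9.3 («simultaneity is free at the archimedean places»): the four conditions at `w` share `δ_w`, so they can be
met by ONE choice of `sgn(Im δ_w)` exactly when the products `sgn(a_j(w)) · sgn(k_j(w))` agree for `j = 0, 1, 2, 3` —
`exists_deltaSign_iff`; and then the choice is forced: `sgn(Im δ_w) = −sgn(a_j(w)) sgn(k_j(w))` (`deltaSign_unique`).  The
face's signature identity (N1 at the real places) is what makes the four products agree — the route's reading, the
hypothesis `e2_real` of `PeriodCloserC7LineClassesFin.lean` in its precise form (`ArchData.e2_real_iff`).

**What this is not.**  `sgn`, `k_j(w)` and `δ_w` are parameters of a small archimedean interface (`ArchData`); nothing about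
the octic face's exponents (on no page) is evaluated.  Nothing here says anything about the status of the Hodge conjecture
for CM abelian varieties, which is NOT proved.
-/

set_option autoImplicit false

noncomputable section

namespace Summit.Ventures.HodgeRepro.PeriodCloser

/-- **The archimedean data of one real place** for the four lines: the signature `sgn_j = sgn(a_j(w)) ∈ {±1}` of the
line `W_j` at `w` and the sign `sgnk_j = sgn(k_j(w))` of its (odd) slot exponent. -/
structure ArchData where
  /-- the signature `sgn(a_j(w))` of the line `W_j` at `w` -/
  sgn : Fin 4 → ℤˣ
  /-- the sign `sgn(k_j(w))` of the slot exponent of `χ′_j` at `w` -/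
  sgnk : Fin 4 → ℤˣ

namespace ArchData

/-- **(9.2) for the line `j`** with `s = sgn(Im δ_w)`: `sgn(a_j(w)) = −sgn(k_j(w)) · s`. -/
def Cond (A : ArchData) (s : ℤˣ) (j : Fin 4) : Prop := A.sgn j = -(A.sgnk j) * s

/-- **(E2) at the real place `w`**: (9.2) for all four lines with ONE `δ_w`. -/
def E2Real (A : ArchData) : Prop := ∃ s : ℤˣ, ∀ j : Fin 4, A.Cond s j

/-- The product `sgn(a_j(w)) · sgn(k_j(w))` of the line `j`. -/
def prod (A : ArchData) (j : Fin 4) : ℤˣ := A.sgn j * A.sgnk j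

/-- (9.2) for the line `j` says `s = −sgn(a_j(w)) · sgn(k_j(w))`. -/
theorem cond_iff (A : ArchData) (s : ℤˣ) (j : Fin 4) : A.Cond s j ↔ s = -(A.prod j) := by
  unfold Cond prod
  constructor
  · intro h
    rw [h]
    rcases Int.units_eq_one_or (A.sgnk j) with h1 | h1 <;> rcases Int.units_eq_one_or s with h2 | h2 <;>
      simp [h1, h2]
  · intro h
    rw [h]
    rcases Int.units_eq_one_or (A.sgnk j) with h1 | h1 <;> rcases Int.units_eq_one_or (A.sgn j) with h2 | h2 <;>
      simp [h1, h2]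

/-- **Simultaneity (ROUTE-B §9.3)**: the four conditions at `w` can be met by ONE `sgn(Im δ_w)` iff the four products
`sgn(a_j(w)) · sgn(k_j(w))` coincide. -/
theorem exists_deltaSign_iff (A : ArchData) : A.E2Real ↔ ∀ j j' : Fin 4, A.prod j = A.prod j' := by
  constructor
  · rintro ⟨s, hs⟩ j j'
    have h1 := (A.cond_iff s j).mp (hs j)
    have h2 := (A.cond_iff s j').mp (hs j')
    exact neg_injective (h1.symm.trans h2)
  · intro h
    refine ⟨-(A.prod 0), fun j => ?_⟩
    rw [A.cond_iff, h j 0]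

/-- **The sign of `δ_w` is forced** by any one line: `sgn(Im δ_w) = −sgn(a_j(w)) · sgn(k_j(w))`. -/
theorem deltaSign_unique (A : ArchData) (s : ℤˣ) (hs : ∀ j : Fin 4, A.Cond s j) (j : Fin 4) :
    s = -(A.prod j) :=
  (A.cond_iff s j).mp (hs j)

/-- **The face's signature identity makes (E2)_w free**: if the products agree pairwise along the seesaw (lines `0, 1`
against `2, 3`) and within each plane, (E2) holds at `w`. -/
theorem e2Real_of_products (A : ArchData) (h01 : A.prod 0 = A.prod 1) (h12 : A.prod 1 = A.prod 2)
    (h23 : A.prod 2 = A.prod 3) : A.E2Real := by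
  rw [A.exists_deltaSign_iff]
  intro j j'
  have h : ∀ i : Fin 4, A.prod i = A.prod 0 := by
    intro i
    fin_cases i
    · rfl
    · exact h01.symm
    · exact (h01.trans h12).symm
    · exact (h01.trans (h12.trans h23)).symm
  rw [h j, h j']

end ArchData

end Summit.Ventures.HodgeRepro.PeriodCloser

end
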